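import Summits.ResolutionOfSingularities.ResolutionOfSingularities.Theorems.FrobeniusLadderFRationalResolutionMonoidAlgebraModel
import HarnessLib

/-!
# Crux `FrobeniusLadder.FRationalResolution` (stmt-ResolutionOfSingularities-15317), line `redirect`,
# stub `stub_diagonalizableQuotientResolution` — THE VERTEX IDEAL OF `κ[P]` IS GENERATED BY THE MONOMIALS OF A GENERATING SET
# (the slot `hxv : 𝔳^{b+1} = (xv₁,…,xv_N)` of the monoid-algebra certificate for `b = 0`)

`…MonoidAlgebraModel.hasResolution_of_isolated_fixedPoints_of_monoidAlgebra_certificate` (p843485) asks for generators `xv` of the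
centre `𝔳_P^{b+1}` as a `Fin`-indexed family. For the point blow-up (`b = 0`) of the monoid algebra `κ[P]`, `P = ⟨G⟩` with `G` finite
(a Hilbert basis), the vertex ideal `𝔳_P = (χᵖ : 0 ≠ p ∈ P)` is generated by the finitely many `χᵍ`, `g ∈ G`: every non-zero
`p ∈ ⟨G⟩` is `g + q` with `g ∈ G`, `q ∈ ⟨G⟩`, so `χᵖ = χᵍ χ^q`.

* `exists_mem_add_of_mem_closure` — a non-zero element of `⟨G⟩` has a summand in `G`;
* ★ `vertexIdeal_eq_span_image` — `𝔳_P = (χᵍ : g ∈ G)`;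
* ★★ `exists_fin_generators_vertexIdeal` — a `Fin`-indexed family of monomials `χᵍ`, `g ∈ G`, with `𝔳_P ^ (0 + 1) = (xv)`, in the
  exact shape of the certificate's slot.

Honest label: elementary plumbing toward ONE leaf stub (no stub, crux or summit closed). No definitions, no named facts, no sorry.
[folklore; cite: CoxLittleSchenck2011, §1.1 and Prop. 1.2.23 (Hilbert basis)]
-/

noncomputable section

-- single-problem summit: the doubled namespace component is forced
set_option linter.dupNamespace false

namespace Summit.ResolutionOfSingularities.ResolutionOfSingularities.Theorems.FRationalResolution.MonoidAlgebraModel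

variable (κ : Type) [Field κ] {n : ℕ} (P : AddSubmonoid (Fin n →₀ ℕ))

/-- The vertex ideal `𝔳_P = (χᵖ : 0 ≠ p ∈ P)` of the monoid algebra `κ[P]`. -/
local notation3 (prettyPrint := false) "𝕍[" κ ", " P "]" =>
  Ideal.span ((fun p : ↥P => AddMonoidAlgebra.single p (1 : κ)) '' {p : ↥P | p ≠ 0})

omit [Field κ] in
/-- A non-zero element of `⟨G⟩ ⊆ ℕⁿ` is `g + q` with `g ∈ G` and `q ∈ ⟨G⟩`. [folklore] -/
theorem exists_mem_add_of_mem_closure (G : Set (Fin n →₀ ℕ)) {p : Fin n →₀ ℕ} (hp : p ∈ AddSubmonoid.closure G)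
    (hp0 : p ≠ 0) : ∃ g ∈ G, ∃ q ∈ AddSubmonoid.closure G, p = g + q := by
  revert hp0
  induction hp using AddSubmonoid.closure_induction with
  | mem x hx => exact fun _ => ⟨x, hx, 0, zero_mem _, (add_zero x).symm⟩
  | zero => exact fun h => absurd rfl h
  | add x y hx hy ihx ihy =>
    intro hxy
    by_cases hx0 : x = 0
    · subst hx0
      rw [zero_add] at hxy ⊢
      exact ihy hxy
    · obtain ⟨g, hg, q, hq, rfl⟩ := ihx hx0
      exact ⟨g, hg, q + y, add_mem hq hy, by rw [add_assoc]⟩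

/-- ★ **`𝔳_P` is generated by the monomials of a generating set**: `𝔳_P = (χᵍ : g ∈ G)` for `P = ⟨G⟩`, `0 ∉ G`.
[folklore; cite: CoxLittleSchenck2011, §1.1] -/
theorem vertexIdeal_eq_span_image (G : Set (Fin n →₀ ℕ)) (hG0 : (0 : Fin n →₀ ℕ) ∉ G) (hGP : AddSubmonoid.closure G = P) :
    𝕍[κ, P] = Ideal.span ((fun p : ↥P => AddMonoidAlgebra.single p (1 : κ)) ''
      {p : ↥P | (p : Fin n →₀ ℕ) ∈ G}) := by
  apply le_antisymm
  · rw [Ideal.span_le]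
    rintro _ ⟨p, hp, rfl⟩
    have hpc : (p : Fin n →₀ ℕ) ∈ AddSubmonoid.closure G := hGP ▸ p.2
    have hp0 : (p : Fin n →₀ ℕ) ≠ 0 := fun h => hp (Subtype.ext h)
    obtain ⟨g, hg, q, hq, hpq⟩ := exists_mem_add_of_mem_closure G hpc hp0
    have hgP : g ∈ P := hGP ▸ AddSubmonoid.subset_closure hg
    have hqP : q ∈ P := hGP ▸ hq
    have hpeq : p = ⟨g, hgP⟩ + ⟨q, hqP⟩ := Subtype.ext hpq
    have hmul : AddMonoidAlgebra.single p (1 : κ) =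
        AddMonoidAlgebra.single (⟨q, hqP⟩ : ↥P) (1 : κ) * AddMonoidAlgebra.single (⟨g, hgP⟩ : ↥P) 1 := by
      rw [AddMonoidAlgebra.single_mul_single, mul_one, hpeq, add_comm]
    change AddMonoidAlgebra.single p (1 : κ) ∈ _
    rw [hmul]
    exact Ideal.mul_mem_left _ _ (Ideal.subset_span ⟨⟨g, hgP⟩, hg, rfl⟩)
  · apply Ideal.span_mono
    rintro _ ⟨p, hp, rfl⟩
    refine ⟨p, ?_, rfl⟩
    intro h
    exact hG0 (by simpa [h] using hp)

/-- ★★ **`Fin`-indexed monomial generators of `𝔳_P`** for a finite generating set `G ∌ 0` of `P`, in the shape of the slot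
`hxv : 𝔳 ^ (b + 1) = Ideal.span (Set.range xv)` (`b = 0`) of the monoid-algebra certificate. [folklore] -/
theorem exists_fin_generators_vertexIdeal (G : Set (Fin n →₀ ℕ)) (hGfin : G.Finite) (hG0 : (0 : Fin n →₀ ℕ) ∉ G)
    (hGP : AddSubmonoid.closure G = P) :
    ∃ (N : ℕ) (xv : Fin N → AddMonoidAlgebra κ ↥P),
      (∀ i, ∃ p : ↥P, (p : Fin n →₀ ℕ) ∈ G ∧ xv i = AddMonoidAlgebra.single p 1) ∧
      (∀ g ∈ G, ∃ i, ∃ p : ↥P, (p : Fin n →₀ ℕ) = g ∧ xv i = AddMonoidAlgebra.single p 1) ∧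
      𝕍[κ, P] ^ (0 + 1) = Ideal.span (Set.range xv) := by
  classical
  -- enumerate `G`
  obtain ⟨N, f, hf⟩ := hGfin.fin_embedding
  have hfG : ∀ i, f i ∈ G := fun i => hf ▸ ⟨i, rfl⟩
  have hfP : ∀ i, f i ∈ P := fun i => hGP ▸ AddSubmonoid.subset_closure (hfG i)
  refine ⟨N, fun i => AddMonoidAlgebra.single (⟨f i, hfP i⟩ : ↥P) 1, fun i => ⟨⟨f i, hfP i⟩, hfG i, rfl⟩, ?_, ?_⟩
  · intro g hg
    obtain ⟨i, hi⟩ : g ∈ Set.range f := hf ▸ hg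
    exact ⟨i, ⟨f i, hfP i⟩, hi, rfl⟩
  · rw [zero_add, pow_one, vertexIdeal_eq_span_image κ P G hG0 hGP]
    congr 1
    ext z
    constructor
    · rintro ⟨p, hp, rfl⟩
      obtain ⟨i, hi⟩ : (p : Fin n →₀ ℕ) ∈ Set.range f := hf ▸ hp
      refine ⟨i, ?_⟩
      have : (⟨f i, hfP i⟩ : ↥P) = p := Subtype.ext hi
      simp only [this]
    · rintro ⟨i, rfl⟩
      exact ⟨⟨f i, hfP i⟩, hfG i, rfl⟩

end Summit.ResolutionOfSingularities.ResolutionOfSingularities.Theorems.FRationalResolution.MonoidAlgebraModel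

end
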